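import Summits.ValiantsHypothesis.ValiantsHypothesis.Theorems.BarrierLeverChowCubeReduction
import Summits.ValiantsHypothesis.ValiantsHypothesis.Theorems.BarrierLeverChowCubeThetaHatPeel

/-!
# Route BarrierLever — items 20195 / 20172: CUBE CERTIFICATES — from `det Θ̂ ≠ 0` on the compressed
# columns to a Chow hit of the original layout

Helper file (`--supports stmt-ValiantsHypothesis-20195`; cell valiant-natproofs, rung V4, 𝒟-side of
door (c); seat val-np-p2 gen 8).  Closes NO item; definition-free.  Assembles
`…ChowCubeReduction` (one compression step ↔ one cube-type factor `s_c + y_c`),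
`…ChowCubeThetaHat` (Γ-reduction: the x-private design on down-closed columns has `det = det Θ̂`) and
`…ChowCubeThetaHatPeel` (`Θ̂` under ring homomorphisms).

* `exists_chowFactors_of_chain` — CHAIN FORM of the cube reduction: let `w = w₀, w₁, …, w_n` be the
  successive down-compressions of an injective column family along a duplicate-free list of
  coordinates `c₁, …, c_n` (given as a sequence `ws` with the defining equations).  If some product
  `∏ g` hits `(u, w_n)` then `(∏ g) · ∏_k (s_{c_k} + y_{c_k})` hits `(u, w)` for suitable scalars.
* `chain_injective`, `chain_closed` — `w_n` is injective and closed under removing each `c_k`.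
* `chow_hit_of_det_thetaHat_ne_zero` — THE CERTIFICATE: rows `u` arbitrary, columns `w` injective,
  a compression chain through ALL coordinates ending in `δ`; if `det Θ̂_X[u, δ] ≠ 0` in the
  polynomial ring `MvPolynomial (Fin h × Fin h) ℂ` (generic table), then `(u, w)` is Chow-hit by
  `h + h` affine forms — the x-private forms `x_a + 1 + Σ_c q_{ac} y_c` at a suitable table `q` and
  the cube-type factors `s_c + y_c`.  The hypothesis `det Θ̂_X ≠ 0` is what the peeling rules
  (V), (P1)–(P3) of `…ChowCubeThetaHatPeel[Step]` establish.

WHAT THIS IS NOT: a certificate mechanism for item 20195 (and 20172); the items stay open; nothing on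
crux stmt-ValiantsHypothesis-14610 or on `VP` versus `VNP`.
-/

set_option linter.dupNamespace false

namespace Summit.ValiantsHypothesis.ValiantsHypothesis.Theorems.BarrierLever.ChowCube

open Finset MvPolynomial
open Summit.ValiantsHypothesis.ValiantsHypothesis.Theorems.BarrierLever.ChowFactor
  (totalDegree_X_add_le)

variable {h r : ℕ}

/-! ## 1. Compression chains -/

/-- Along a compression chain the families stay injective. -/
theorem chain_injective (L : List (Fin h)) :
    ∀ (ws : ℕ → (Fin r → Finset (Fin h))), Function.Injective (ws 0) →
      (∀ k (hk : k < L.length) j, ws (k + 1) j =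
        if L[k] ∈ ws k j ∧ (∀ j', ws k j' ≠ (ws k j).erase L[k]) then (ws k j).erase L[k]
        else ws k j) →
      Function.Injective (ws L.length) := by
  induction L with
  | nil => intro ws h0 _; exact h0
  | cons c L ih =>
    intro ws h0 hstep
    have hw1 : ∀ j, ws 1 j = if c ∈ ws 0 j ∧ (∀ j', ws 0 j' ≠ (ws 0 j).erase c) then (ws 0 j).erase c
        else ws 0 j := fun j => by
      have e := hstep 0 (Nat.zero_lt_succ _) j
      simp only [List.getElem_cons_zero] at e
      exact e
    have h1 : Function.Injective (ws 1) := compress_injective (ws 0) (ws 1) c h0 hw1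
    exact ih (fun k => ws (k + 1)) h1 (fun k hk j => by
      have e := hstep (k + 1) (Nat.succ_lt_succ hk) j
      simp only [List.getElem_cons_succ] at e
      exact e)

/-- Along a compression chain the final family is closed under removing every listed coordinate
(and keeps any closedness the initial family had). -/
theorem chain_closed (L : List (Fin h)) :
    ∀ (ws : ℕ → (Fin r → Finset (Fin h))) (K₀ : Finset (Fin h)),
      (∀ c ∈ K₀, ∀ j, c ∈ ws 0 j → ∃ j', ws 0 j' = (ws 0 j).erase c) →
      (∀ k (hk : k < L.length) j, ws (k + 1) j =
        if L[k] ∈ ws k j ∧ (∀ j', ws k j' ≠ (ws k j).erase L[k]) then (ws k j).erase L[k]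
        else ws k j) →
      ∀ c, (c ∈ K₀ ∨ c ∈ L) → ∀ j, c ∈ ws L.length j → ∃ j', ws L.length j' = (ws L.length j).erase c := by
  induction L with
  | nil =>
    intro ws K₀ hK₀ _ c hc
    rcases hc with hc | hc
    · exact hK₀ c hc
    · simp at hc
  | cons c₀ L ih =>
    intro ws K₀ hK₀ hstep c hc
    have hw1 : ∀ j, ws 1 j = if c₀ ∈ ws 0 j ∧ (∀ j', ws 0 j' ≠ (ws 0 j).erase c₀) then (ws 0 j).erase c₀
        else ws 0 j := fun j => by
      have e := hstep 0 (Nat.zero_lt_succ _) j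
      simp only [List.getElem_cons_zero] at e
      exact e
    have hK₁ : ∀ c ∈ insert c₀ K₀, ∀ j, c ∈ ws 1 j → ∃ j', ws 1 j' = (ws 1 j).erase c := by
      intro c hc
      rcases Finset.mem_insert.mp hc with e | hc
      · rw [e]
        exact compress_closed_self (ws 0) (ws 1) c₀ hw1
      · exact compress_closed_of_closed (ws 0) (ws 1) c₀ c hw1 (hK₀ c hc)
    exact ih (fun k => ws (k + 1)) (insert c₀ K₀) hK₁ (fun k hk j => by
      have e := hstep (k + 1) (Nat.succ_lt_succ hk) j
      simp only [List.getElem_cons_succ] at e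
      exact e) c (by
        rcases hc with hc | hc
        · exact Or.inl (Finset.mem_insert_of_mem hc)
        · rcases List.mem_cons.mp hc with e | hc
          · exact Or.inl (e ▸ Finset.mem_insert_self c₀ K₀)
          · exact Or.inr hc)

/-- **CHAIN FORM OF THE CUBE REDUCTION.**  If `∏ g` hits `(u, w_n)` for the end `w_n` of a
compression chain of `w = w₀` along a duplicate-free list `L` of coordinates, then for suitable
scalars `s`, `(∏ g) · ∏_{c ∈ L} (s_c + y_c)` hits `(u, w)`. -/
theorem exists_chowFactors_of_chain (u : Fin r → Finset (Fin h)) (m : ℕ) (L : List (Fin h))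
    (hL : L.Nodup) :
    ∀ (ws : ℕ → (Fin r → Finset (Fin h))), Function.Injective (ws 0) →
      (∀ k (hk : k < L.length) j, ws (k + 1) j =
        if L[k] ∈ ws k j ∧ (∀ j', ws k j' ≠ (ws k j).erase L[k]) then (ws k j).erase L[k]
        else ws k j) →
      ∀ (g : Fin m → MvPolynomial (Fin (h + h)) ℂ),
        (Matrix.of fun i j : Fin r => coeff
          (∑ a ∈ u i, Finsupp.single (Fin.castAdd h a) 1 +
            ∑ c ∈ ws L.length j, Finsupp.single (Fin.natAdd h c) 1) (∏ k, g k)).det ≠ 0 →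
        ∃ s : Fin h → ℂ, (Matrix.of fun i j : Fin r => coeff
          (∑ a ∈ u i, Finsupp.single (Fin.castAdd h a) 1 +
            ∑ c ∈ ws 0 j, Finsupp.single (Fin.natAdd h c) 1)
          ((∏ k, g k) * ∏ c ∈ L.toFinset, (C (s c) + X (Fin.natAdd h c)))).det ≠ 0 := by
  classical
  induction L with
  | nil =>
    intro ws _ _ g hdet
    refine ⟨fun _ => 0, ?_⟩
    rw [List.toFinset_nil, Finset.prod_empty, mul_one]
    exact hdet
  | cons c L ih =>
    intro ws h0 hstep g hdet
    have hcL : c ∉ L := (List.nodup_cons.mp hL).1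
    have hw1 : ∀ j, ws 1 j = if c ∈ ws 0 j ∧ (∀ j', ws 0 j' ≠ (ws 0 j).erase c) then (ws 0 j).erase c
        else ws 0 j := fun j => by
      have e := hstep 0 (Nat.zero_lt_succ _) j
      simp only [List.getElem_cons_zero] at e
      exact e
    have h1 : Function.Injective (ws 1) := compress_injective (ws 0) (ws 1) c h0 hw1
    obtain ⟨s, hs⟩ := ih (List.nodup_cons.mp hL).2 (fun k => ws (k + 1)) h1
      (fun k hk j => by
        have e := hstep (k + 1) (Nat.succ_lt_succ hk) j
        simp only [List.getElem_cons_succ] at e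
        exact e) g hdet
    -- one compression step for the column function of `F = (∏ g) · ∏_{c' ∈ L} (s_{c'} + y_{c'})`
    set F : MvPolynomial (Fin (h + h)) ℂ := (∏ k, g k) * ∏ c' ∈ L.toFinset, (C (s c') + X (Fin.natAdd h c'))
      with hF
    set A : Finset (Fin h) → Fin r → ℂ := fun W i => coeff
      (∑ a ∈ u i, Finsupp.single (Fin.castAdd h a) 1 + ∑ c' ∈ W, Finsupp.single (Fin.natAdd h c') 1) F
      with hA
    have hdetA : (Matrix.of fun i j => A (ws 1 j) i).det ≠ 0 := hs
    obtain ⟨t, ht⟩ := exists_det_compressStep_ne_zero A (ws 0) (ws 1) c h0 hw1 hdetA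
    refine ⟨Function.update s c t, ?_⟩
    have hprodL : ∏ c' ∈ L.toFinset, (C (Function.update s c t c') + X (Fin.natAdd h c') :
        MvPolynomial (Fin (h + h)) ℂ) = ∏ c' ∈ L.toFinset, (C (s c') + X (Fin.natAdd h c')) := by
      refine Finset.prod_congr rfl fun c' hc' => ?_
      have hne : c' ≠ c := fun e => hcL (e ▸ List.mem_toFinset.mp hc')
      rw [Function.update_of_ne hne]
    have hcL' : c ∉ L.toFinset := fun hh => hcL (List.mem_toFinset.mp hh)
    have hpoly : (∏ k, g k) * ∏ c' ∈ (c :: L).toFinset, (C (Function.update s c t c') +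
        X (Fin.natAdd h c')) = F * (C t + X (Fin.natAdd h c)) := by
      rw [List.toFinset_cons, Finset.prod_insert hcL', Function.update_self, hprodL, hF, mul_assoc,
        mul_comm (C t + _)]
    have hM : (Matrix.of fun i j : Fin r => coeff
        (∑ a ∈ u i, Finsupp.single (Fin.castAdd h a) 1 + ∑ c' ∈ ws 0 j, Finsupp.single (Fin.natAdd h c') 1)
        ((∏ k, g k) * ∏ c' ∈ (c :: L).toFinset, (C (Function.update s c t c') + X (Fin.natAdd h c')))) =
        Matrix.of fun i j => t * A (ws 0 j) i + (if c ∈ ws 0 j then A ((ws 0 j).erase c) i else 0) := by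
      ext i j
      rw [Matrix.of_apply, Matrix.of_apply, hpoly, coeff_partitionExpo_mul_C_add_X]
    rw [hM]
    exact ht


/-! ## 2. From single-coordinate closedness to down-closedness -/

/-- A family closed under removing every single element of its members is down-closed. -/
theorem downClosed_of_erase_closed {ι : Type*} (δ : ι → Finset (Fin h))
    (hcl : ∀ c j, c ∈ δ j → ∃ j', δ j' = (δ j).erase c) :
    ∀ j (S : Finset (Fin h)), S ⊆ δ j → ∃ j', δ j' = S := by
  classical
  have key : ∀ n : ℕ, ∀ j (S : Finset (Fin h)), S ⊆ δ j → (δ j \ S).card = n → ∃ j', δ j' = S := by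
    intro n
    induction n with
    | zero =>
      intro j S hS hn
      refine ⟨j, Finset.Subset.antisymm ?_ hS⟩
      exact Finset.sdiff_eq_empty_iff_subset.mp (Finset.card_eq_zero.mp hn)
    | succ n ih =>
      intro j S hS hn
      obtain ⟨c, hc⟩ : (δ j \ S).Nonempty := Finset.card_pos.mp (by omega)
      obtain ⟨j₁, hj₁⟩ := hcl c j (Finset.mem_sdiff.mp hc).1
      have hS₁ : S ⊆ δ j₁ := by
        rw [hj₁]
        intro x hx
        exact Finset.mem_erase.mpr ⟨fun e => (Finset.mem_sdiff.mp hc).2 (e ▸ hx), hS hx⟩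
      refine ih j₁ S hS₁ ?_
      rw [hj₁, Finset.erase_sdiff_comm, Finset.card_erase_of_mem hc, hn]
      rfl
  exact fun j S hS => key _ j S hS rfl

/-! ## 3. The certificate: `det Θ̂_X ≠ 0` on the compressed columns ⟹ Chow hit -/

/-- The x-private forms `x_a + 1 + Σ_c q_{ac} y_c` have total degree `≤ 1`. -/
theorem totalDegree_xPrivateForm_le (q : Fin h → Fin h → ℂ) (a : Fin h) :
    (X (Fin.castAdd h a) + (1 + ∑ c, C (q a c) * X (Fin.natAdd h c)) :
      MvPolynomial (Fin (h + h)) ℂ).totalDegree ≤ 1 := by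
  refine totalDegree_X_add_le a _ ((totalDegree_add _ _).trans (max_le ?_ ?_))
  · rw [totalDegree_one]; exact Nat.zero_le _
  · refine totalDegree_finsetSum_le fun c _ => (totalDegree_mul _ _).trans ?_
    rw [totalDegree_C, totalDegree_X, zero_add]

/-- **THE CUBE CERTIFICATE.**  Rows `u` arbitrary, columns `w` injective; `ws` a compression chain of
`w` along a duplicate-free list `L` exhausting the coordinates, ending in `δ = ws L.length`; `Θ = Θ̂_X`
the truncated-inverse matrix over the generic table.  If `det Θ[u, δ] ≠ 0` (as a polynomial), then
`(u, w)` is Chow-hit by `h + h` affine forms (x-private forms at a suitable table, and cube-type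
factors `s_c + y_c`). -/
theorem chow_hit_of_det_thetaHat_ne_zero (u w : Fin r → Finset (Fin h)) (hw : Function.Injective w)
    (L : List (Fin h)) (hL : L.Nodup) (hLall : ∀ c, c ∈ L)
    (ws : ℕ → (Fin r → Finset (Fin h))) (hws0 : ws 0 = w)
    (hstep : ∀ k (hk : k < L.length) j, ws (k + 1) j =
      if L[k] ∈ ws k j ∧ (∀ j', ws k j' ≠ (ws k j).erase L[k]) then (ws k j).erase L[k] else ws k j)
    (Θ : Finset (Fin h) → Finset (Fin h) → MvPolynomial (Fin h × Fin h) ℂ)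
    (hΘ : ∀ U S, Θ U S = coeff (∑ a ∈ (∅ : Finset (Fin h)), Finsupp.single (Fin.castAdd h a) 1 +
        ∑ c ∈ S, Finsupp.single (Fin.natAdd h c) 1)
      (∏ a ∈ U, ∑ S' ∈ (Finset.univ : Finset (Fin h)).powerset,
        monomial (∑ a' ∈ (∅ : Finset (Fin h)), Finsupp.single (Fin.castAdd h a') 1 +
          ∑ c ∈ S', Finsupp.single (Fin.natAdd h c) 1)
          ((-1 : MvPolynomial (Fin h × Fin h) ℂ) ^ S'.card *
            (S'.card.factorial : MvPolynomial (Fin h × Fin h) ℂ) * ∏ c ∈ S', X (a, c)) :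
            MvPolynomial (Fin (h + h)) (MvPolynomial (Fin h × Fin h) ℂ)))
    (hdet : (Matrix.of fun i j : Fin r => Θ (u i) (ws L.length j)).det ≠ 0) :
    ∃ ℓ : Fin (h + h) → MvPolynomial (Fin (h + h)) ℂ, (∀ k, (ℓ k).totalDegree ≤ 1) ∧
      (Matrix.of fun i j : Fin r => coeff
        (∑ a ∈ u i, Finsupp.single (Fin.castAdd h a) 1 + ∑ c ∈ w j, Finsupp.single (Fin.natAdd h c) 1)
        (∏ k, ℓ k)).det ≠ 0 := by
  classical
  -- the compressed family is injective and down-closed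
  have h0inj : Function.Injective (ws 0) := by rw [hws0]; exact hw
  have hδinj : Function.Injective (ws L.length) := chain_injective L ws h0inj hstep
  have hδcl : ∀ j (S : Finset (Fin h)), S ⊆ ws L.length j → ∃ j', ws L.length j' = S :=
    downClosed_of_erase_closed _ fun c j hc => chain_closed L ws ∅
      (fun c hc => absurd hc (Finset.notMem_empty c)) hstep c (Or.inr (hLall c)) j hc
  -- a table `q` where the determinant does not vanish
  obtain ⟨x, hx⟩ : ∃ x : Fin h × Fin h → ℂ,
      MvPolynomial.eval x (Matrix.of fun i j : Fin r => Θ (u i) (ws L.length j)).det ≠ 0 := by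
    by_contra hall
    push Not at hall
    exact hdet (MvPolynomial.funext fun x => by rw [hall x, map_zero])
  set q : Fin h → Fin h → ℂ := fun a c => x (a, c) with hq
  rw [RingHom.map_det] at hx
  have hentry : (MvPolynomial.eval x).mapMatrix (Matrix.of fun i j : Fin r => Θ (u i) (ws L.length j)) =
      Matrix.of fun i j' : Fin r => coeff
        (∑ a ∈ (∅ : Finset (Fin h)), Finsupp.single (Fin.castAdd h a) 1 +
            ∑ c ∈ ws L.length j', Finsupp.single (Fin.natAdd h c) 1)
          (∏ a ∈ u i, ∑ S ∈ (Finset.univ : Finset (Fin h)).powerset,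
            monomial (∑ a' ∈ (∅ : Finset (Fin h)), Finsupp.single (Fin.castAdd h a') 1 +
              ∑ c ∈ S, Finsupp.single (Fin.natAdd h c) 1)
              ((-1 : ℂ) ^ S.card * (S.card.factorial : ℂ) * ∏ c ∈ S, q a c) :
                MvPolynomial (Fin (h + h)) ℂ) := by
    ext i j
    rw [RingHom.mapMatrix_apply, Matrix.map_apply, Matrix.of_apply, Matrix.of_apply, hΘ, map_thetaHat]
    simp_rw [eval_X]
    rfl
  rw [hentry, ← det_xPrivate_eq_det_thetaHat q u (ws L.length) hδinj hδcl] at hx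
  -- the cube factors
  obtain ⟨s, hs⟩ := exists_chowFactors_of_chain u h L hL ws h0inj hstep
    (fun a => X (Fin.castAdd h a) + (1 + ∑ c, C (q a c) * X (Fin.natAdd h c))) hx
  have hLuniv : L.toFinset = Finset.univ :=
    Finset.eq_univ_iff_forall.mpr fun c => List.mem_toFinset.mpr (hLall c)
  rw [hLuniv, hws0] at hs
  refine ⟨Fin.append (fun a => X (Fin.castAdd h a) + (1 + ∑ c, C (q a c) * X (Fin.natAdd h c)))
    (fun c => C (s c) + X (Fin.natAdd h c)), fun k => ?_, ?_⟩
  · induction k using Fin.addCases with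
    | left a =>
      rw [Fin.append_left]
      exact totalDegree_xPrivateForm_le q a
    | right c =>
      rw [Fin.append_right]
      exact totalDegree_C_add_X_natAdd_le (s c) c
  · have hprod : (∏ k, Fin.append (fun a => X (Fin.castAdd h a) + (1 + ∑ c, C (q a c) * X (Fin.natAdd h c)))
        (fun c => C (s c) + X (Fin.natAdd h c)) k) =
        (∏ a, (X (Fin.castAdd h a) + (1 + ∑ c, C (q a c) * X (Fin.natAdd h c)))) *
          ∏ c, (C (s c) + X (Fin.natAdd h c)) := by
      rw [Fin.prod_univ_add]
      simp only [Fin.append_left, Fin.append_right]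
    rw [hprod]
    exact hs

end Summit.ValiantsHypothesis.ValiantsHypothesis.Theorems.BarrierLever.ChowCube
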